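import Literature.Analysis.Quadrature.LatticeRules

/-!
# Tent-transformed (baker-periodised) lattice rules

Companion to `Literature.Analysis.Quadrature.LatticeRules`: the tent transformation
`φ(x) = 1 - |2x - 1|` of Hickernell (2002), applied componentwise to the nodes of a rank-1 lattice
rule (after an optional random shift), turns the lattice-rule error theory for periodic integrands
(Fourier coefficients on the dual lattice) into an error theory for NON-periodic integrands in terms
of their half-period COSINE coefficients.  We formalise the mechanism of
Dick–Nuyens–Pillichshammer, *Lattice rules for nonperiodic smooth integrands*, Numer. Math. 126
(2014) 259–291, §4.1 (`DickNuyensPillichshammer2013`, arXiv:1211.3799):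

* `tent`, `tentMap` — the tent transformation on `ℝ/ℤ` and on `(ℝ/ℤ)ᵈ`; on `[0,1]` it is
  `1 - |2x - 1|` (`tent_coe_of_mem_Icc`, `tent_coe_eq_fract`);
* `cos_pi_mul_tent` — the identity `cos(π k φ(x)) = cos(2π k x)` [DNP14, §4.1];
* `measurePreserving_tent`, `measurePreserving_tentMap`, `integral_comp_tentMap` — `φ` is Lebesgue
  measure preserving [DNP14, §1]: `∫_{𝕋ᵈ} g(φ(x)) dx = ∫_{[0,1]ᵈ} g`;
* `cosSystem`, `cosCoeff` — the half-period cosine system `2^{|k|₀/2} ∏ cos(π k_j y_j)` and the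
  cosine coefficients `f̃_cos(k)` [DNP14, §2.3];
* `mFourierCoeff_comp_tentMap` — the key identity `(f ∘ φ)^(h) = (√2)^{-|h|₀} f̃_cos(|h|)`
  [DNP14, §4.1, proof of Thm. 2], and `summable_mFourierCoeff_comp_tentMap`;
* `hasSum_latticeRule_tent_sub_integral` — the error formula (err_fo_tent) of [DNP14, §4.1]:
  `Q_{n,z}(f ∘ φ) - ∫_{[0,1]ᵈ} f = Σ_{0 ≠ h ∈ L⊥} (√2)^{-|h|₀} f̃_cos(|h|)`, with the norm bound
  `norm_latticeRule_tent_sub_integral_le` and its comparison form (the first step of the proof of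
  [DNP14, Thm. 2]; the worst-case / Cauchy–Schwarz step is left to clients);
* `integral_latticeRule_tent_add_eq`, `hasSum_integral_norm_sq_latticeRule_tent_sub` — random shift
  THEN tent (Hickernell 2002, as used by [DNP14, §1] and Lemieux 2009 §6.2): the estimator is
  unbiased for `∫_{[0,1]ᵈ} f` and its shift-variance is `Σ_{0 ≠ h ∈ L⊥} 2^{-|h|₀} |f̃_cos(|h|)|²`
  (Lemieux 2009, Prop. 6.2 applied to `f ∘ φ`).

Conventions: as in `LatticeRules`, the torus `𝕋ᵈ = (ℝ/ℤ)ᵈ` carries the Haar probability measure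
(local instances below) and Mathlib's characters `mFourier h` / coefficients `mFourierCoeff`; the
cube `[0,1]ᵈ = Set.Icc 0 1 ⊆ (d → ℝ)` carries Lebesgue measure.  Integrands are `ℂ`-valued.

References: J. Dick, D. Nuyens, F. Pillichshammer, Numer. Math. 126 (2014) 259–291
(`DickNuyensPillichshammer2013`); F. J. Hickernell, in: Monte Carlo and Quasi-Monte Carlo Methods
2000, Springer (2002) 274–289 (cited through [DNP14, ref. H02]); C. Lemieux, *Monte Carlo and
Quasi-Monte Carlo Sampling*, Springer (2009), §6.2 (`Lemieux2009`).

AI-produced formalisation (H21 engines group, seat eng-quad-1, 2026-08-21); no facts, no axioms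
beyond Mathlib's, no `sorry`.
-/

open scoped Real
open MeasureTheory Finset UnitAddTorus

noncomputable section

namespace Literature.Analysis.Quadrature

attribute [local instance] latticeRules_measureSpace latticeRules_isAddHaarMeasure
  latticeRules_isProbabilityMeasure

variable {d : Type*} [Fintype d]

/-! ### The tent transformation on `ℝ/ℤ` -/

/-- The tent (baker's) transformation on `ℝ/ℤ`: `φ(x) = 2‖x‖`, i.e. twice the distance to the
nearest integer; on `[0,1]` this is `1 - |2x - 1|`. [cite: DickNuyensPillichshammer2013, §1] -/
def tent (x : UnitAddCircle) : ℝ := 2 * ‖x‖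

/-- `0 ≤ φ(x)`. [folklore] -/
private theorem tent_nonneg (x : UnitAddCircle) : 0 ≤ tent x := by
  unfold tent; positivity

/-- `φ(x) ≤ 1`. [folklore] -/
private theorem tent_le_one (x : UnitAddCircle) : tent x ≤ 1 := by
  have h := AddCircle.norm_le_half_period (p := (1 : ℝ)) (x := x) one_ne_zero
  rw [abs_one] at h
  unfold tent; linarith

/-- `φ : [0,1] → [0,1]`, i.e. `φ(x) ∈ [0,1]`. [cite: DickNuyensPillichshammer2013, §1] -/
theorem tent_mem_Icc (x : UnitAddCircle) : tent x ∈ Set.Icc (0 : ℝ) 1 :=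
  ⟨tent_nonneg x, tent_le_one x⟩

/-- `φ(-x) = φ(x)`. [folklore] -/
@[simp] private theorem tent_neg (x : UnitAddCircle) : tent (-x) = tent x := by
  simp [tent, norm_neg]

/-- `φ` is continuous. [folklore] -/
private theorem continuous_tent : Continuous tent := continuous_const.mul continuous_norm

/-- `φ(t mod 1) = 2 |t - round t|`. [folklore] -/
private theorem tent_coe (t : ℝ) : tent (t : UnitAddCircle) = 2 * |t - round t| := by
  rw [tent, UnitAddCircle.norm_eq]

/-- On `[0,1]` the tent transformation is `φ(t) = 1 - |2t - 1|`.
[cite: DickNuyensPillichshammer2013, §4.1] -/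
theorem tent_coe_of_mem_Icc {t : ℝ} (ht : t ∈ Set.Icc (0 : ℝ) 1) :
    tent (t : UnitAddCircle) = 1 - |2 * t - 1| := by
  rw [tent_coe]
  rcases lt_or_ge t (1 / 2) with h | h
  · have hr : round t = 0 := by
      rw [round_eq_zero_iff, Set.mem_Ico]; constructor <;> linarith [ht.1]
    rw [hr, Int.cast_zero, sub_zero, abs_of_nonneg ht.1, abs_of_nonpos (by linarith)]
    ring
  · have hr : round t = 1 := by
      rw [round_eq, Int.floor_eq_iff]; constructor <;> push_cast <;> linarith [ht.2]
    rw [hr, Int.cast_one, abs_of_nonpos (by linarith [ht.2]), abs_of_nonneg (by linarith)]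
    ring

/-- For every real `t`: `φ(t mod 1) = 1 - |2{t} - 1|` with `{t}` the fractional part (DNP14 apply
`φ` to the fractional parts `{n g / N}`). [cite: DickNuyensPillichshammer2013, §4.1] -/
theorem tent_coe_eq_fract (t : ℝ) : tent (t : UnitAddCircle) = 1 - |2 * Int.fract t - 1| := by
  have h : ((t : ℝ) : UnitAddCircle) = ((Int.fract t : ℝ) : UnitAddCircle) := by
    rw [eq_comm, ← sub_eq_zero, ← AddCircle.coe_sub, Int.fract, sub_sub_cancel_left,
      AddCircle.coe_neg, neg_eq_zero, AddCircle.coe_eq_zero_iff]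
    exact ⟨⌊t⌋, by simp⟩
  rw [h, tent_coe_of_mem_Icc ⟨Int.fract_nonneg t, (Int.fract_lt_one t).le⟩]

/-- **The tent transformation halves frequencies** [cite: DickNuyensPillichshammer2013, §4.1]
(the display `cos(π k φ(x)) = cos(2π k x)` in the proof of Theorem 2), for every integer `k` and
real `t`. -/
theorem cos_pi_mul_tent (k : ℤ) (t : ℝ) :
    Real.cos (π * k * tent (t : UnitAddCircle)) = Real.cos (2 * π * k * t) := by
  rw [tent_coe]
  rcases abs_choice (t - round t) with h | h <;> rw [h]
  · have : π * k * (2 * (t - round t)) = 2 * π * k * t - ((k * round t : ℤ) : ℝ) * (2 * π) := by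
      push_cast; ring
    rw [this, Real.cos_sub_int_mul_two_pi]
  · have : π * k * (2 * -(t - round t)) = -(2 * π * k * t - ((k * round t : ℤ) : ℝ) * (2 * π)) := by
      push_cast; ring
    rw [this, Real.cos_neg, Real.cos_sub_int_mul_two_pi]

/-- `e_k(x) + e_{-k}(x) = 2 cos(π k φ(x))` on `ℝ/ℤ` (`e_k(x) = e^{2πi k x}`): the identity
`cos(2π k x) = (e_k(x) + e_{-k}(x))/2` combined with `cos_pi_mul_tent`, as used in the proof of
Theorem 2 of [cite: DickNuyensPillichshammer2013, §4.1]. -/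
theorem fourier_add_fourier_neg (k : ℤ) (x : UnitAddCircle) :
    (fourier k x : ℂ) + fourier (-k) x = ((2 * Real.cos (π * k * tent x) : ℝ) : ℂ) := by
  induction x using QuotientAddGroup.induction_on with
  | H t =>
    rw [cos_pi_mul_tent, fourier_coe_apply, fourier_coe_apply]
    push_cast
    rw [Complex.two_cos]
    congr 1 <;> (congr 1; ring)

/-! ### The componentwise tent transformation on `(ℝ/ℤ)ᵈ` -/

/-- The componentwise tent transformation `φ : (ℝ/ℤ)ᵈ → [0,1]ᵈ ⊆ ℝᵈ`.
[cite: DickNuyensPillichshammer2013, §4.1] -/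
def tentMap (x : UnitAddTorus d) : d → ℝ := fun j => tent (x j)

omit [Fintype d] in
/-- `φ(x)_j = φ(x_j)`: "for vectors we apply the function `φ` component-wise".
[cite: DickNuyensPillichshammer2013, §4.1] -/
@[simp] theorem tentMap_apply (x : UnitAddTorus d) (j : d) : tentMap x j = tent (x j) := rfl

omit [Fintype d] in
/-- `φ` is continuous. [folklore] -/
private theorem continuous_tentMap : Continuous (tentMap (d := d)) :=
  continuous_pi fun j => continuous_tent.comp (continuous_apply j)

omit [Fintype d] in
/-- `φ` maps `𝕋ᵈ` into the unit cube `[0,1]ᵈ` (`φ : [0,1] → [0,1]` component-wise).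
[cite: DickNuyensPillichshammer2013, §1] -/
theorem tentMap_mem_Icc (x : UnitAddTorus d) : tentMap x ∈ Set.Icc (0 : d → ℝ) 1 :=
  ⟨fun j => tent_nonneg (x j), fun j => tent_le_one (x j)⟩

omit [Fintype d] in
/-- The tent-transformed lattice nodes are DNP14's `φ({i z / n})`: coordinate `j` of node `i` is
`1 - |2 {i z_j / n} - 1|` with `{i z_j / n} = ((z_j i) mod n) / n`.
[cite: DickNuyensPillichshammer2013, §4.1] -/
theorem tentMap_latticeNode (n : ℕ) [NeZero n] (z : d → ℤ) (i : ZMod n) (j : d) :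
    tentMap (latticeNode n z i) j = 1 - |2 * ((((z j : ZMod n) * i).val : ℝ) / n) - 1| := by
  rw [tentMap_apply, latticeNode, ZMod.toAddCircle_apply, tent_coe_of_mem_Icc]
  have hn : (0 : ℝ) < n := by exact_mod_cast Nat.pos_of_ne_zero (NeZero.ne n)
  constructor
  · positivity
  · rw [div_le_one hn]
    exact_mod_cast (ZMod.val_lt _).le

/-! ### `φ` is Lebesgue measure preserving -/

/-- **`φ` is measure preserving** (one coordinate): the image of the Haar probability measure of
`ℝ/ℤ` under `φ` is Lebesgue measure on `[0,1]`. [cite: DickNuyensPillichshammer2013, §1] -/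
theorem measurePreserving_tent :
    MeasurePreserving tent (volume : Measure UnitAddCircle)
      ((volume : Measure ℝ).restrict (Set.Icc 0 1)) := by
  refine ⟨continuous_tent.measurable, ?_⟩
  refine Measure.ext_of_Iic _ _ fun a => ?_
  rw [Measure.map_apply continuous_tent.measurable measurableSet_Iic,
    Measure.restrict_apply measurableSet_Iic]
  have h1 : tent ⁻¹' Set.Iic a = Metric.closedBall (0 : UnitAddCircle) (a / 2) := by
    ext x
    simp only [Set.mem_preimage, Set.mem_Iic, Metric.mem_closedBall, dist_zero_right, tent]
    constructor <;> intro h <;> linarith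
  have h2 : Set.Iic a ∩ Set.Icc (0 : ℝ) 1 = Set.Icc 0 (min a 1) := by
    ext x
    simp only [Set.mem_inter_iff, Set.mem_Iic, Set.mem_Icc, le_min_iff]
    tauto
  have h3 := AddCircle.volume_closedBall (T := 1) (x := (0 : UnitAddCircle)) (a / 2)
  rw [AddCircle.volume_eq_smul_haarAddCircle, ENNReal.ofReal_one, one_smul] at h3
  rw [h1, h2, Real.volume_Icc, sub_zero]
  change AddCircle.haarAddCircle _ = _
  rw [h3, min_comm, mul_div_cancel₀ _ (two_ne_zero)]

/-- **`φ` is measure preserving** [cite: DickNuyensPillichshammer2013, §1] ("`φ` is a Lebesgue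
measure preserving function"): the image of the Haar probability measure of `(ℝ/ℤ)ᵈ` under the
componentwise tent transformation is Lebesgue measure on the cube `[0,1]ᵈ`. -/
theorem measurePreserving_tentMap :
    MeasurePreserving (tentMap (d := d)) volume
      ((volume : Measure (d → ℝ)).restrict (Set.Icc 0 1)) := by
  have h : Set.Icc (0 : d → ℝ) 1 = Set.univ.pi fun _ => Set.Icc (0 : ℝ) 1 :=
    (Set.pi_univ_Icc (0 : d → ℝ) 1).symm
  rw [h, volume_pi, volume_pi, Measure.restrict_pi_pi]
  exact measurePreserving_pi _ _ fun _ => measurePreserving_tent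

/-- **Change of variables under `φ`** [cite: DickNuyensPillichshammer2013, §1]:
`∫_{𝕋ᵈ} g(φ(x)) dx = ∫_{[0,1]ᵈ} g(y) dy` for every `g` that is a.e.-strongly measurable on the cube
(in particular every integrable or continuous `g`). -/
theorem integral_comp_tentMap {E : Type*} [NormedAddCommGroup E] [NormedSpace ℝ E]
    {g : (d → ℝ) → E}
    (hg : AEStronglyMeasurable g ((volume : Measure (d → ℝ)).restrict (Set.Icc 0 1))) :
    ∫ x, g (tentMap x) = ∫ y in Set.Icc (0 : d → ℝ) 1, g y := by
  have h := integral_map (μ := (volume : Measure (UnitAddTorus d)))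
    (measurePreserving_tentMap (d := d)).measurable.aemeasurable (f := g)
    (by rw [measurePreserving_tentMap.map_eq]; exact hg)
  rw [measurePreserving_tentMap.map_eq] at h
  exact h.symm

/-- `g ∘ φ` is integrable on `𝕋ᵈ` iff `g` is integrable on `[0,1]ᵈ` (`φ` is measure preserving).
[cite: DickNuyensPillichshammer2013, §1] -/
theorem integrable_comp_tentMap_iff {E : Type*} [NormedAddCommGroup E] {g : (d → ℝ) → E}
    (hg : AEStronglyMeasurable g ((volume : Measure (d → ℝ)).restrict (Set.Icc 0 1))) :
    Integrable (g ∘ tentMap) (volume : Measure (UnitAddTorus d)) ↔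
      IntegrableOn g (Set.Icc (0 : d → ℝ) 1) :=
  measurePreserving_tentMap.integrable_comp hg


/-! ### Sign changes of coordinates -/

/-- A sign pattern `ε ∈ {±1}ᵈ` (coded as `d → Bool`, `true = +1`) acting on frequencies:
`(ε h)_j = ± h_j`. [folklore] -/
def sgnFlip (ε : d → Bool) (h : d → ℤ) : d → ℤ := fun j => if ε j then h j else -h j

/-- The same sign pattern acting on the torus: `(ε x)_j = ± x_j`. [folklore] -/
def torusFlip (ε : d → Bool) (x : UnitAddTorus d) : UnitAddTorus d :=
  fun j => if ε j then x j else -x j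

omit [Fintype d] in
/-- `ε (-h) = -(ε h)`. [folklore] -/
private theorem sgnFlip_neg (ε : d → Bool) (h : d → ℤ) : sgnFlip ε (-h) = -sgnFlip ε h := by
  ext j
  simp only [sgnFlip, Pi.neg_apply]
  split_ifs <;> simp

omit [Fintype d] in
/-- `|ε h| = |h|` coordinatewise. [folklore] -/
private theorem natAbs_sgnFlip (ε : d → Bool) (h : d → ℤ) (j : d) :
    (sgnFlip ε h j).natAbs = (h j).natAbs := by
  simp only [sgnFlip]
  split_ifs <;> simp

omit [Fintype d] in
/-- `φ` is blind to sign changes: `φ(ε x) = φ(x)`. [folklore] -/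
@[simp] private theorem tentMap_torusFlip (ε : d → Bool) (x : UnitAddTorus d) :
    tentMap (torusFlip ε x) = tentMap x := by
  ext j
  simp only [tentMap_apply, torusFlip]
  split_ifs <;> simp

/-- Characters under sign changes: `e_h(ε x) = e_{ε h}(x)`. [folklore] -/
private theorem mFourier_torusFlip (ε : d → Bool) (h : d → ℤ) (x : UnitAddTorus d) :
    mFourier h (torusFlip ε x) = mFourier (sgnFlip ε h) x := by
  simp only [mFourier, ContinuousMap.coe_mk, torusFlip, sgnFlip]
  refine prod_congr rfl fun j _ => ?_
  by_cases hj : ε j = true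
  · rw [if_pos hj, if_pos hj]
  · rw [if_neg hj, if_neg hj, fourier_apply, fourier_apply, zsmul_neg, ← neg_zsmul]

/-- Sign changes of coordinates preserve the Haar measure of `(ℝ/ℤ)ᵈ` (each coordinate map is the
identity or negation, and Haar measure on the compact abelian group `ℝ/ℤ` is negation invariant).
[folklore] -/
private theorem measurePreserving_torusFlip (ε : d → Bool) :
    MeasurePreserving (torusFlip ε) (volume : Measure (UnitAddTorus d)) volume := by
  have h : ∀ j, MeasurePreserving (fun y : UnitAddCircle => if ε j then y else -y)
      volume volume := by
    intro j
    by_cases hj : ε j = true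
    · simp only [if_pos hj]
      exact MeasurePreserving.id volume
    · simp only [if_neg hj]
      exact Measure.measurePreserving_neg volume
  rw [volume_pi]
  exact measurePreserving_pi _ _ h

/-- **Sum over sign patterns of the characters** : `Σ_{ε ∈ {±1}ᵈ} e_{ε h}(x) = ∏_j 2 cos(π h_j φ(x_j))`
(from `e_k + e_{-k} = 2 cos(π k φ)`): the pointwise identity behind the regrouping
`Σ_k (√2)^{|k|₀} f̃_cos(k) ∏_j cos(2π k_j x_j) = Σ_{h ∈ ℤᵈ} (√2)^{-|h|₀} f̃_cos(|h|) e_h(x)` in the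
proof of Theorem 2 of [cite: DickNuyensPillichshammer2013, §4.1]. -/
theorem sum_mFourier_sgnFlip [DecidableEq d] (h : d → ℤ) (x : UnitAddTorus d) :
    ∑ ε : d → Bool, mFourier (sgnFlip ε h) x =
      ∏ j, (((2 * Real.cos (π * h j * tent (x j)) : ℝ)) : ℂ) := by
  have key : ∀ j, (((2 * Real.cos (π * h j * tent (x j)) : ℝ)) : ℂ) =
      ∑ b : Bool, (fourier (if b then h j else -h j) (x j) : ℂ) := by
    intro j
    rw [Fintype.sum_bool, if_pos rfl, if_neg Bool.false_ne_true, fourier_add_fourier_neg]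
  simp_rw [key]
  simp only [mFourier, ContinuousMap.coe_mk, sgnFlip]
  exact (Fintype.prod_sum fun j (b : Bool) => (fourier (if b then h j else -h j) (x j) : ℂ)).symm

/-! ### The half-period cosine system and cosine coefficients -/

open Classical in
/-- `|k|₀`: the number of nonzero coordinates of `k`. [cite: DickNuyensPillichshammer2013, §2.3] -/
def numNonzero {M : Type*} [Zero M] (k : d → M) : ℕ := (univ.filter fun j => k j ≠ 0).card

/-- `|h| = (|h_1|, …, |h_d|) ∈ ℕ₀ᵈ` for `h ∈ ℤᵈ`. [cite: DickNuyensPillichshammer2013, §2.3] -/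
def absVec (h : d → ℤ) : d → ℕ := fun j => (h j).natAbs

omit [Fintype d] in
/-- `|h|_j = |h_j|`. [folklore] -/
@[simp] private theorem absVec_apply (h : d → ℤ) (j : d) : absVec h j = (h j).natAbs := rfl

/-- `||h||₀ = |h|₀` (the weight `2^{-|h|₀}` attached to `f̃_cos(|h|)`, `h ∈ ℤᵈ`).
[cite: DickNuyensPillichshammer2013, §2.3] -/
@[simp] theorem numNonzero_absVec (h : d → ℤ) : numNonzero (absVec h) = numNonzero h := by
  simp only [numNonzero, absVec_apply, ne_eq, Int.natAbs_eq_zero]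

omit [Fintype d] in
/-- `|ε h| = |h|`. [folklore] -/
@[simp] private theorem absVec_sgnFlip (ε : d → Bool) (h : d → ℤ) : absVec (sgnFlip ε h) = absVec h := by
  ext j
  exact natAbs_sgnFlip ε h j

/-- `|ε h|₀ = |h|₀`. [folklore] -/
@[simp] private theorem numNonzero_sgnFlip (ε : d → Bool) (h : d → ℤ) :
    numNonzero (sgnFlip ε h) = numNonzero h := by
  rw [← numNonzero_absVec, absVec_sgnFlip, numNonzero_absVec]

/-- The half-period cosine system on `[0,1]ᵈ`: `c_k(y) = 2^{|k|₀/2} ∏_j cos(π k_j y_j)`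
(an orthonormal basis of `L²([0,1]ᵈ)`). [cite: DickNuyensPillichshammer2013, §2.3] -/
def cosSystem (k : d → ℕ) (y : d → ℝ) : ℝ :=
  Real.sqrt 2 ^ numNonzero k * ∏ j, Real.cos (π * k j * y j)

/-- The cosine coefficients of `f : [0,1]ᵈ → ℂ`: `f̃_cos(k) = ∫_{[0,1]ᵈ} f(y) c_k(y) dy`.
[cite: DickNuyensPillichshammer2013, §2.3] -/
def cosCoeff (f : (d → ℝ) → ℂ) (k : d → ℕ) : ℂ :=
  ∫ y in Set.Icc (0 : d → ℝ) 1, f y * cosSystem k y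

/-- `∏_j 2 cos(π h_j y_j) = 2ᵈ (√2)^{-|h|₀} c_{|h|}(y)`. [folklore] -/
private theorem prod_two_mul_cos_eq (h : d → ℤ) (y : d → ℝ) :
    ∏ j, (2 * Real.cos (π * h j * y j)) =
      2 ^ Fintype.card d * ((Real.sqrt 2 ^ numNonzero h)⁻¹ * cosSystem (absVec h) y) := by
  have hc : ∀ j, Real.cos (π * (absVec h j : ℝ) * y j) = Real.cos (π * h j * y j) := by
    intro j
    rw [absVec_apply, Nat.cast_natAbs, Int.cast_abs]
    rcases abs_choice (h j : ℝ) with e | e <;> rw [e]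
    rw [mul_neg, neg_mul, Real.cos_neg]
  simp only [cosSystem, numNonzero_absVec, hc]
  rw [inv_mul_cancel_left₀ (pow_ne_zero _ (Real.sqrt_ne_zero'.mpr two_pos)), prod_mul_distrib,
    prod_const, card_univ]

/-- `e_m • g` is integrable on `𝕋ᵈ` whenever `g` is. [folklore] -/
private theorem integrable_mFourier_smul_of_integrable {g : UnitAddTorus d → ℂ} (hg : Integrable g)
    (m : d → ℤ) : Integrable (fun t => mFourier m t • g t) :=
  hg.bdd_smul 1 (mFourier m).continuous.aestronglyMeasurable
    (ae_of_all _ fun t => ((mFourier m).norm_coe_le_norm t).trans_eq mFourier_norm)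

/-! ### Fourier coefficients of `f ∘ φ` are cosine coefficients of `f` -/

/-- The Fourier coefficients of `f ∘ φ` are invariant under sign changes of the frequency:
`(f∘φ)^(ε h) = (f∘φ)^(h)` (substitute `x ↦ ε x`, which preserves Haar measure and `φ`).
[folklore] -/
private theorem mFourierCoeff_comp_tentMap_sgnFlip {f : (d → ℝ) → ℂ} (hf : IntegrableOn f (Set.Icc 0 1))
    (ε : d → Bool) (h : d → ℤ) :
    mFourierCoeff (f ∘ tentMap) (sgnFlip ε h) = mFourierCoeff (f ∘ tentMap) h := by
  have hg : Integrable (f ∘ tentMap) (volume : Measure (UnitAddTorus d)) :=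
    (integrable_comp_tentMap_iff hf.aestronglyMeasurable).mpr hf
  have H := integral_map (μ := (volume : Measure (UnitAddTorus d)))
    (measurePreserving_torusFlip ε).measurable.aemeasurable
    (f := fun t => mFourier (-h) t • (f ∘ tentMap) t)
    (by
      rw [(measurePreserving_torusFlip ε).map_eq]
      exact (integrable_mFourier_smul_of_integrable hg (-h)).aestronglyMeasurable)
  rw [(measurePreserving_torusFlip ε).map_eq] at H
  simp only [mFourierCoeff]
  rw [H]
  congr 1
  ext s
  simp only [Function.comp_apply, mFourier_torusFlip, sgnFlip_neg, tentMap_torusFlip]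

/-- **Fourier coefficients of the tent-periodised integrand are cosine coefficients**
[cite: DickNuyensPillichshammer2013, §4.1] (the computation in the proof of Theorem 2, written
coefficient-wise): for `f` integrable on `[0,1]ᵈ` and every `h ∈ ℤᵈ`,
`(f ∘ φ)^(h) = (√2)^{-|h|₀} · f̃_cos(|h|)`. -/
theorem mFourierCoeff_comp_tentMap {f : (d → ℝ) → ℂ} (hf : IntegrableOn f (Set.Icc 0 1))
    (h : d → ℤ) :
    mFourierCoeff (f ∘ tentMap) h =
      ((Real.sqrt 2 ^ numNonzero h)⁻¹ : ℝ) • cosCoeff f (absVec h) := by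
  classical
  set g : UnitAddTorus d → ℂ := f ∘ tentMap with hg_def
  have hg : Integrable g (volume : Measure (UnitAddTorus d)) :=
    (integrable_comp_tentMap_iff hf.aestronglyMeasurable).mpr hf
  -- (1) average over the `2ᵈ` sign patterns
  have h1 : (Fintype.card (d → Bool) : ℂ) * mFourierCoeff g h =
      ∑ ε : d → Bool, mFourierCoeff g (sgnFlip ε h) := by
    rw [sum_congr rfl fun ε _ => mFourierCoeff_comp_tentMap_sgnFlip hf ε h, sum_const, card_univ,
      nsmul_eq_mul]
  -- (2) the averaged character is a product of cosines of `φ`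
  have h2 : ∑ ε : d → Bool, mFourierCoeff g (sgnFlip ε h) =
      ∫ t, (∏ j, (((2 * Real.cos (π * h j * tent (t j)) : ℝ)) : ℂ)) * g t := by
    simp only [mFourierCoeff, smul_eq_mul]
    rw [← integral_finsetSum _ (fun ε _ => ?_)]
    · congr 1
      ext t
      rw [← sum_mul]
      congr 1
      have e : ∀ ε : d → Bool, mFourier (-sgnFlip ε h) t = mFourier (sgnFlip ε (-h)) t :=
        fun ε => by rw [sgnFlip_neg]
      simp_rw [e, sum_mFourier_sgnFlip (-h) t]
      refine prod_congr rfl fun j _ => ?_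
      simp only [Pi.neg_apply, Int.cast_neg, mul_neg, neg_mul, Real.cos_neg]
    · simpa only [smul_eq_mul] using integrable_mFourier_smul_of_integrable hg (-sgnFlip ε h)
  -- (3) pull the integral back to the cube
  have hFm : AEStronglyMeasurable
      (fun y : d → ℝ => (((∏ j, (2 * Real.cos (π * h j * y j)) : ℝ)) : ℂ) * f y)
      ((volume : Measure (d → ℝ)).restrict (Set.Icc 0 1)) := by
    refine (Continuous.aestronglyMeasurable ?_).mul hf.aestronglyMeasurable
    fun_prop
  have h3 : ∫ t, (∏ j, (((2 * Real.cos (π * h j * tent (t j)) : ℝ)) : ℂ)) * g t =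
      ((2 : ℝ) ^ Fintype.card d * (Real.sqrt 2 ^ numNonzero h)⁻¹) • cosCoeff f (absVec h) := by
    calc ∫ t, (∏ j, (((2 * Real.cos (π * h j * tent (t j)) : ℝ)) : ℂ)) * g t
        = ∫ t, (fun y : d → ℝ => (((∏ j, (2 * Real.cos (π * h j * y j)) : ℝ)) : ℂ) * f y)
            (tentMap t) := by
          congr 1
          ext t
          simp only [hg_def, Function.comp_apply, tentMap_apply]
          push_cast
          rfl
      _ = ∫ y in Set.Icc (0 : d → ℝ) 1, (((∏ j, (2 * Real.cos (π * h j * y j)) : ℝ)) : ℂ) * f y :=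
          integral_comp_tentMap hFm
      _ = ∫ y in Set.Icc (0 : d → ℝ) 1,
            ((2 : ℝ) ^ Fintype.card d * (Real.sqrt 2 ^ numNonzero h)⁻¹) • (f y * cosSystem (absVec h) y) := by
          congr 1
          ext y
          rw [prod_two_mul_cos_eq, Complex.real_smul]
          push_cast
          ring
      _ = ((2 : ℝ) ^ Fintype.card d * (Real.sqrt 2 ^ numNonzero h)⁻¹) • cosCoeff f (absVec h) := by
          rw [integral_smul]
          rfl
  -- (4) cancel the factor `2ᵈ`
  have hcard : (Fintype.card (d → Bool) : ℂ) = (2 : ℂ) ^ Fintype.card d := by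
    rw [Fintype.card_fun, Fintype.card_bool]
    push_cast
    rfl
  have H : (Fintype.card (d → Bool) : ℂ) * mFourierCoeff g h =
      ((2 : ℝ) ^ Fintype.card d * (Real.sqrt 2 ^ numNonzero h)⁻¹) • cosCoeff f (absVec h) := by
    rw [h1, h2, h3]
  rw [hcard] at H
  refine mul_left_cancel₀ (pow_ne_zero (Fintype.card d) (two_ne_zero (α := ℂ))) ?_
  rw [H, Complex.real_smul, Complex.real_smul]
  push_cast
  ring

/-- The norm of the `h`-th Fourier coefficient of `f ∘ φ` is `(√2)^{-|h|₀} |f̃_cos(|h|)|`.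
[cite: DickNuyensPillichshammer2013, §4.1] -/
theorem norm_mFourierCoeff_comp_tentMap {f : (d → ℝ) → ℂ} (hf : IntegrableOn f (Set.Icc 0 1))
    (h : d → ℤ) :
    ‖mFourierCoeff (f ∘ tentMap) h‖ = (Real.sqrt 2 ^ numNonzero h)⁻¹ * ‖cosCoeff f (absVec h)‖ := by
  rw [mFourierCoeff_comp_tentMap hf, norm_smul, Real.norm_of_nonneg (by positivity)]

/-! ### Summability: cosine coefficients of `f` vs Fourier coefficients of `f ∘ φ` -/

/-- A nonnegative function is summable if it is summable along each of finitely many injective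
"sections" `s_i` of a map `u` whose ranges cover the index type. [folklore] -/
private theorem summable_of_sections {α β ι : Type*} [Fintype ι] {g : β → ℝ} (hg : ∀ b, 0 ≤ g b)
    (u : β → α) (s : ι → α → β) (hus : ∀ i a, u (s i a) = a) (hcov : ∀ b, ∃ i, s i (u b) = b)
    (hs : ∀ i, Summable (g ∘ s i)) : Summable g := by
  classical
  have hinj : ∀ i, Function.Injective (s i) := fun i =>
    Function.LeftInverse.injective (g := u) (hus i)
  have hG : ∀ i, Summable (fun b => if s i (u b) = b then g b else 0) := by
    intro i
    refine ((hinj i).summable_iff ?_).mp ?_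
    · intro b hb
      rw [if_neg]
      intro e
      exact hb ⟨u b, e⟩
    · refine (hs i).congr fun a => ?_
      simp only [Function.comp_apply, hus i a, if_true]
  refine Summable.of_nonneg_of_le hg (fun b => ?_) (summable_sum fun i (_ : i ∈ univ) => hG i)
  obtain ⟨i, hi⟩ := hcov b
  calc g b = (if s i (u b) = b then g b else 0) := by rw [if_pos hi]
    _ ≤ ∑ i, (if s i (u b) = b then g b else 0) :=
        single_le_sum (f := fun i => if s i (u b) = b then g b else 0)
          (fun k _ => by
            split_ifs
            · exact hg b
            · exact le_rfl) (mem_univ i)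

/-- **Absolutely summable cosine coefficients give absolutely summable Fourier coefficients of
`f ∘ φ`** [cite: DickNuyensPillichshammer2013, §4.1] (the regrouping
`Σ_k (√2)^{|k|₀} |f̃_cos(k)| … = Σ_{h ∈ ℤᵈ} (√2)^{-|h|₀} |f̃_cos(|h|)|` in the proof of Theorem 2;
here as the qualitative statement `Σ_k |f̃_cos(k)| < ∞ ⇒ Σ_h |(f∘φ)^(h)| < ∞`). -/
theorem summable_mFourierCoeff_comp_tentMap {f : (d → ℝ) → ℂ} (hf : IntegrableOn f (Set.Icc 0 1))
    (hs : Summable (cosCoeff f)) : Summable (mFourierCoeff (f ∘ tentMap)) := by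
  classical
  refine Summable.of_norm ?_
  refine summable_of_sections (ι := d → Bool) (fun h => norm_nonneg _) absVec
    (fun ε k j => if ε j then (k j : ℤ) else -(k j : ℤ)) ?_ ?_ ?_
  · intro ε k
    ext j
    simp only [absVec_apply]
    split_ifs <;> simp
  · intro h
    refine ⟨fun j => decide (0 ≤ h j), ?_⟩
    ext j
    simp only [absVec_apply, decide_eq_true_eq, Nat.cast_natAbs, Int.cast_id]
    split_ifs with hj
    · exact abs_of_nonneg hj
    · rw [abs_of_neg (lt_of_not_ge hj), neg_neg]
  · intro ε
    refine Summable.of_nonneg_of_le (fun k => norm_nonneg _) (fun k => ?_) hs.norm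
    have hk : absVec (fun j => if ε j then (k j : ℤ) else -(k j : ℤ)) = k := by
      ext j
      simp only [absVec_apply]
      split_ifs <;> simp
    simp only [Function.comp_apply, norm_mFourierCoeff_comp_tentMap hf, hk]
    refine mul_le_of_le_one_left (norm_nonneg _) (inv_le_one_of_one_le₀ ?_)
    exact one_le_pow₀ (Real.one_le_sqrt.mpr one_le_two)

/-! ### The error of a tent-transformed lattice rule -/

/-- The tent-periodised integrand `f ∘ φ ∈ C(𝕋ᵈ, ℂ)` of an `f` continuous on `[0,1]ᵈ`.
[cite: DickNuyensPillichshammer2013, §4.1] -/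
def tentPeriodise (f : (d → ℝ) → ℂ) (hf : ContinuousOn f (Set.Icc 0 1)) : C(UnitAddTorus d, ℂ) :=
  ⟨f ∘ tentMap, hf.comp_continuous continuous_tentMap tentMap_mem_Icc⟩

omit [Fintype d] in
/-- `(f ∘ φ)(x) = f(φ(x))` (the tent-transformed integrand). [cite: DickNuyensPillichshammer2013, §4.1] -/
@[simp] theorem tentPeriodise_apply (f : (d → ℝ) → ℂ) (hf : ContinuousOn f (Set.Icc 0 1))
    (x : UnitAddTorus d) : tentPeriodise f hf x = f (tentMap x) := rfl

/-- **Error of a tent-transformed lattice rule** [cite: DickNuyensPillichshammer2013, §4.1]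
(eq. (err_fo_tent) in the proof of Theorem 2): for `f` continuous on `[0,1]ᵈ` with absolutely
summable cosine coefficients,
`Q_{n,z}(f ∘ φ) - ∫_{[0,1]ᵈ} f = Σ_{0 ≠ h ∈ L⊥} (√2)^{-|h|₀} f̃_cos(|h|)` (absolutely convergent). -/
theorem hasSum_latticeRule_tent_sub_integral (n : ℕ) [NeZero n] (z : d → ℤ)
    {f : (d → ℝ) → ℂ} (hf : ContinuousOn f (Set.Icc 0 1)) (hs : Summable (cosCoeff f)) :
    HasSum (fun h : ((dualLattice n z : Set (d → ℤ)) \ {0} : Set (d → ℤ)) =>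
        ((Real.sqrt 2 ^ numNonzero (h : d → ℤ))⁻¹ : ℝ) • cosCoeff f (absVec h))
      (latticeRule n z (f ∘ tentMap) - ∫ y in Set.Icc (0 : d → ℝ) 1, f y) := by
  have hfi : IntegrableOn f (Set.Icc 0 1) := hf.integrableOn_compact isCompact_Icc
  have hsum : Summable (mFourierCoeff (tentPeriodise f hf)) :=
    summable_mFourierCoeff_comp_tentMap hfi hs
  have H := hasSum_latticeRule_sub_integral n z hsum
  rw [show (∫ x, tentPeriodise f hf x) = ∫ y in Set.Icc (0 : d → ℝ) 1, f y from
    integral_comp_tentMap hfi.aestronglyMeasurable] at H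
  exact H.congr_fun fun h => (mFourierCoeff_comp_tentMap hfi h).symm

/-- The error of a tent-transformed lattice rule in `tsum` form.
[cite: DickNuyensPillichshammer2013, §4.1] -/
theorem latticeRule_tent_sub_integral_eq_tsum (n : ℕ) [NeZero n] (z : d → ℤ)
    {f : (d → ℝ) → ℂ} (hf : ContinuousOn f (Set.Icc 0 1)) (hs : Summable (cosCoeff f)) :
    latticeRule n z (f ∘ tentMap) - ∫ y in Set.Icc (0 : d → ℝ) 1, f y =
      ∑' h : ((dualLattice n z : Set (d → ℤ)) \ {0} : Set (d → ℤ)),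
        ((Real.sqrt 2 ^ numNonzero (h : d → ℤ))⁻¹ : ℝ) • cosCoeff f (absVec h) :=
  (hasSum_latticeRule_tent_sub_integral n z hf hs).tsum_eq.symm

/-- `|Q_{n,z}(f ∘ φ) - ∫_{[0,1]ᵈ} f| ≤ Σ_{0 ≠ h ∈ L⊥} (√2)^{-|h|₀} |f̃_cos(|h|)|`.
[cite: DickNuyensPillichshammer2013, §4.1] -/
theorem norm_latticeRule_tent_sub_integral_le (n : ℕ) [NeZero n] (z : d → ℤ)
    {f : (d → ℝ) → ℂ} (hf : ContinuousOn f (Set.Icc 0 1)) (hs : Summable (cosCoeff f)) :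
    ‖latticeRule n z (f ∘ tentMap) - ∫ y in Set.Icc (0 : d → ℝ) 1, f y‖ ≤
      ∑' h : ((dualLattice n z : Set (d → ℤ)) \ {0} : Set (d → ℤ)),
        (Real.sqrt 2 ^ numNonzero (h : d → ℤ))⁻¹ * ‖cosCoeff f (absVec h)‖ := by
  have H := hasSum_latticeRule_tent_sub_integral n z hf hs
  rw [← H.tsum_eq]
  refine (norm_tsum_le_tsum_norm H.summable.norm).trans_eq (tsum_congr fun h => ?_)
  rw [norm_smul, Real.norm_of_nonneg (by positivity)]

/-- **Comparison form** [cite: DickNuyensPillichshammer2013, §4.1]: if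
`(√2)^{-|h|₀} |f̃_cos(|h|)| ≤ b(h)` for all `0 ≠ h ∈ L⊥` and `Σ_{0 ≠ h ∈ L⊥} b(h) = B`, then
`|Q_{n,z}(f ∘ φ) - ∫_{[0,1]ᵈ} f| ≤ B`. -/
theorem norm_latticeRule_tent_sub_integral_le_of_le (n : ℕ) [NeZero n] (z : d → ℤ)
    {f : (d → ℝ) → ℂ} (hf : ContinuousOn f (Set.Icc 0 1)) (hs : Summable (cosCoeff f))
    {b : (d → ℤ) → ℝ} {B : ℝ}
    (hb : ∀ h : d → ℤ, h ≠ 0 → h ∈ dualLattice n z →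
      (Real.sqrt 2 ^ numNonzero h)⁻¹ * ‖cosCoeff f (absVec h)‖ ≤ b h)
    (hB : HasSum (fun h : ((dualLattice n z : Set (d → ℤ)) \ {0} : Set (d → ℤ)) => b h) B) :
    ‖latticeRule n z (f ∘ tentMap) - ∫ y in Set.Icc (0 : d → ℝ) 1, f y‖ ≤ B :=
  (hasSum_latticeRule_tent_sub_integral n z hf hs).norm_le_of_bounded hB fun h => by
    rw [norm_smul, Real.norm_of_nonneg (by positivity)]
    exact hb h (by simpa using h.2.2) h.2.1

/-! ### Random shift, then tent (Hickernell 2002) -/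

/-- **Randomly shifted and then tent-transformed lattice rules are unbiased**
[cite: Lemieux2009, Prop. 6.1] (applied to `f ∘ φ`, with `∫_{𝕋ᵈ} f ∘ φ = ∫_{[0,1]ᵈ} f` from
[DickNuyensPillichshammer2013, §1]): for `f` integrable on `[0,1]ᵈ`,
`∫_{𝕋ᵈ} Q_{n,z}(f(φ(· + Δ))) dΔ = ∫_{[0,1]ᵈ} f`. -/
theorem integral_latticeRule_tent_add_eq (n : ℕ) [NeZero n] (z : d → ℤ)
    {E : Type*} [NormedAddCommGroup E] [NormedSpace ℝ E] {f : (d → ℝ) → E}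
    (hf : IntegrableOn f (Set.Icc 0 1)) :
    ∫ Δ, latticeRule n z (fun x => f (tentMap (x + Δ))) = ∫ y in Set.Icc (0 : d → ℝ) 1, f y := by
  have hg : Integrable (f ∘ tentMap) (volume : Measure (UnitAddTorus d)) :=
    (integrable_comp_tentMap_iff hf.aestronglyMeasurable).mpr hf
  rw [← integral_comp_tentMap hf.aestronglyMeasurable]
  exact integral_latticeRule_add_eq n z hg

/-- **Shift variance of a tent-transformed lattice rule** [cite: Lemieux2009, Prop. 6.2] (applied to
`f ∘ φ`) with [DickNuyensPillichshammer2013, §4.1]: for `f ∈ L²([0,1]ᵈ)`,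
`∫_{𝕋ᵈ} ‖Q_{n,z}(f(φ(· + Δ))) - ∫_{[0,1]ᵈ} f‖² dΔ = Σ_{0 ≠ h ∈ L⊥} 2^{-|h|₀} |f̃_cos(|h|)|²`.
Together with `integral_latticeRule_tent_add_eq` this is the variance of the randomly shifted,
tent-transformed lattice-rule estimator in terms of the cosine coefficients of the integrand. -/
theorem hasSum_integral_norm_sq_latticeRule_tent_sub (n : ℕ) [NeZero n] (z : d → ℤ)
    {f : (d → ℝ) → ℂ} (hf : MemLp f 2 ((volume : Measure (d → ℝ)).restrict (Set.Icc 0 1))) :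
    HasSum (fun h : ((dualLattice n z : Set (d → ℤ)) \ {0} : Set (d → ℤ)) =>
        ((2 : ℝ) ^ numNonzero (h : d → ℤ))⁻¹ * ‖cosCoeff f (absVec h)‖ ^ 2)
      (∫ Δ, ‖latticeRule n z (fun x => f (tentMap (x + Δ))) -
        ∫ y in Set.Icc (0 : d → ℝ) 1, f y‖ ^ 2) := by
  have hg : MemLp (f ∘ tentMap) 2 (volume : Measure (UnitAddTorus d)) :=
    hf.comp_measurePreserving measurePreserving_tentMap
  have hfi : IntegrableOn f (Set.Icc 0 1) :=
    (integrable_comp_tentMap_iff hf.aestronglyMeasurable).mp (hg.integrable one_le_two)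
  have H := hasSum_integral_norm_sq_latticeRule_sub n z hg
  rw [show (∫ x, (f ∘ tentMap) x) = ∫ y in Set.Icc (0 : d → ℝ) 1, f y from
    integral_comp_tentMap hfi.aestronglyMeasurable] at H
  refine H.congr_fun fun h => ?_
  rw [norm_mFourierCoeff_comp_tentMap hfi, mul_pow, inv_pow, ← pow_mul, mul_comm (numNonzero _) 2,
    pow_mul, Real.sq_sqrt zero_le_two]

/-- The shift variance of a tent-transformed lattice rule in `tsum` form.
[cite: Lemieux2009, Prop. 6.2] -/
theorem integral_norm_sq_latticeRule_tent_sub_eq_tsum (n : ℕ) [NeZero n] (z : d → ℤ)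
    {f : (d → ℝ) → ℂ} (hf : MemLp f 2 ((volume : Measure (d → ℝ)).restrict (Set.Icc 0 1))) :
    ∫ Δ, ‖latticeRule n z (fun x => f (tentMap (x + Δ))) - ∫ y in Set.Icc (0 : d → ℝ) 1, f y‖ ^ 2 =
      ∑' h : ((dualLattice n z : Set (d → ℤ)) \ {0} : Set (d → ℤ)),
        ((2 : ℝ) ^ numNonzero (h : d → ℤ))⁻¹ * ‖cosCoeff f (absVec h)‖ ^ 2 :=
  (hasSum_integral_norm_sq_latticeRule_tent_sub n z hf).tsum_eq.symm

end Literature.Analysis.Quadrature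

end
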